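import Literature.AlgebraicGeometry.Morphisms.GroupLawRules
import Mathlib.AlgebraicGeometry.Morphisms.Separated
import HarnessLib

/-!
# Points of `X ×_S T` and the group-law rules: restriction, factorisation, the bridge `σ`/`ρ`, pointwise evaluation ([MumfordFogartyKirwan1994] Ch. 6 §3, p. 126)

Topic `Literature/AlgebraicGeometry/Morphisms`; namespace `Literature.AlgebraicGeometry.Morphisms`.  THEOREMS ONLY (no definition, no named fact, no instance, no
notation, no `sorry`); universe-polymorphic; Mathlib + ★-to-be `Morphisms/GroupLawRules` only.  Cell hodgecm-mathlib (FLOOR 0), P1 sub-line F-4, layer 2, the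
TOOLBOX of the law-locus file ★-to-be `Morphisms/LawLocusOfHomScheme` ((II-c₁) modulo (II-b)) — B-p20 (g14).  HC_CM is proved only modulo the 7 printed citations
until rung 0 closes; this file discharges none of them.

CONTENT.  §0 `exists_restrict_of_datum` (base change of a universal `M₀`-morphism along a `T`-point, as a `T`-morphism with its classification square),
`exists_comp_eq_iff_ker_le` (factorisation through a closed immersion ⟺ kernels, Mathlib `IsClosedImmersion.lift`), `exists_comp_equalizer_ι_left_iff`
(factorisation through an equaliser of `Over S` ⟺ the two composites agree), and the BRIDGE between the two currencies for binary laws on `X_T := X ×_S T`: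
`σ : X_T ×_T X_T ⥲ (X ×_S X) ×_S T : ρ` (`σ_ρ`, `ρ_σ`, `lift_σ`, `pair_ρ`).  §0b POINTWISE EVALUATION of the rules of ★ `GroupLawRules` at points
`a b c : W ⟶ X_T` over a common `W → T`: `triple_assocL ∕ triple_assocR` (`(a,b,c) ↦ (a·b)·c ∕ a·(b·c)` with `a·b := pullback.lift a b ≫ σ ≫ φ`), `point_unitL ∕
point_unitR ∕ point_invL ∕ point_constE`.  All proofs: `pullback.hom_ext` + `simp`.

## References
* [MumfordFogartyKirwan1994] D. Mumford, J. Fogarty, F. Kirwan, *Geometric Invariant Theory*, 3rd ed. (1994), Ch. 6 §3 Prop. 6.16, proof (p. 126); Ch. 0 §1 (p. 2).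
* [GortzWedhorn2020] U. Görtz, T. Wedhorn, *Algebraic Geometry I*, 2nd ed. (2020), Section (4.7) (fibre products and their points).
* [Hartshorne1977] R. Hartshorne, *Algebraic Geometry* (1977), II Ex. 3.11 (closed subschemes and factorisation).
-/

set_option autoImplicit false

noncomputable section

-- Mathlib's `Over`/pull-back API is stated across semireducible wrappers (as in the ★ `AbelianSchemes/*` files).
set_option backward.isDefEq.respectTransparency false

open CategoryTheory CategoryTheory.Limits AlgebraicGeometry

universe u

namespace Literature.AlgebraicGeometry.Morphisms

/-! ### §0 Helpers: restriction of a universal morphism, factorisation through closed immersions and equalisers, the product bridge -/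

/-- **Base change of a universal morphism along a point, as a `T`-morphism**: for `u₀ : Y₀ ×_S M₀ → X₀ ×_S M₀` over `M₀` and `w : T → M₀` over `v`, there is
`φ : Y₀ ×_S T → X₀ ×_S T` over `T` classified by `w` (one `pullback.lift`; B-typ03 (g19)'s `bc`). [cite: MumfordFogartyKirwan1994, Ch. 6 §3 Proposition 6.16, proof (p. 126)] -/
theorem exists_restrict_of_datum {S Y₀ X₀ M₀ T : Scheme.{u}} (q₀ : Y₀ ⟶ S) (p₀ : X₀ ⟶ S) (m₀ : M₀ ⟶ S)
    (u₀ : pullback q₀ m₀ ⟶ pullback p₀ m₀) (hu₀ : u₀ ≫ pullback.snd p₀ m₀ = pullback.snd q₀ m₀) (v : T ⟶ S) (w : T ⟶ M₀)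
    (hw : w ≫ m₀ = v) :
    ∃ φ : pullback q₀ v ⟶ pullback p₀ v, φ ≫ pullback.snd p₀ v = pullback.snd q₀ v ∧
      φ ≫ pullback.map p₀ v p₀ m₀ (𝟙 X₀) w (𝟙 S) (by simp) (by simpa using hw.symm) =
        pullback.map q₀ v q₀ m₀ (𝟙 Y₀) w (𝟙 S) (by simp) (by simpa using hw.symm) ≫ u₀ := by
  have hA : (pullback.map q₀ v q₀ m₀ (𝟙 Y₀) w (𝟙 S) (by simp) (by simpa using hw.symm) ≫ u₀ ≫ pullback.fst p₀ m₀) ≫ p₀ =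
      pullback.snd q₀ v ≫ v := by
    simp only [Category.assoc, pullback.condition, reassoc_of% hu₀, pullback.lift_snd_assoc, hw]
  refine ⟨pullback.lift _ _ hA, pullback.lift_snd _ _ _, ?_⟩
  apply pullback.hom_ext
  · simp
  · simp [hu₀]

/-- **Factorisation through a closed immersion** `c : E → M`: `g` factors through `c` iff `ker c^♯ ≤ ker g^♯` (Mathlib `IsClosedImmersion.lift`,
`Scheme.Hom.le_ker_comp`). [cite: Hartshorne1977, II Ex. 3.11 (p. 92)] -/
theorem exists_comp_eq_iff_ker_le {E M T : Scheme.{u}} (c : E ⟶ M) [IsClosedImmersion c] (g : T ⟶ M) :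
    (∃ g' : T ⟶ E, g' ≫ c = g) ↔ c.ker ≤ g.ker := by
  constructor
  · rintro ⟨g', rfl⟩
    exact g'.le_ker_comp c
  · intro h
    exact ⟨IsClosedImmersion.lift c g h, IsClosedImmersion.lift_fac c g h⟩

/-- **Membership in an equaliser is an identity**: for `S`-morphisms `γ γ' : M₀ → M` (as morphisms of `Over S`) and `w₀ : T → M₀`, `w₀` factors through the
equaliser (Mathlib `equalizer` in `Over S`, read on underlying schemes) iff `w₀ ≫ γ = w₀ ≫ γ'`. [cite: MumfordFogartyKirwan1994, Ch. 6 §3 Proposition 6.16, proof (p. 126)] -/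
theorem exists_comp_equalizer_ι_left_iff {S : Scheme.{u}} {A B : Over S} (γ γ' : A ⟶ B) {T : Scheme.{u}} (w₀ : T ⟶ A.left) :
    (∃ g' : T ⟶ (equalizer γ γ').left, g' ≫ (equalizer.ι γ γ').left = w₀) ↔ w₀ ≫ γ.left = w₀ ≫ γ'.left := by
  constructor
  · rintro ⟨g', rfl⟩
    rw [Category.assoc, Category.assoc, ← Over.comp_left, ← Over.comp_left, equalizer.condition]
  · intro h
    let W : Over S := Over.mk (w₀ ≫ A.hom)
    let W₀ : W ⟶ A := Over.homMk w₀ rfl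
    have hW : W₀ ≫ γ = W₀ ≫ γ' := Over.OverMorphism.ext (by simpa [W₀] using h)
    refine ⟨(equalizer.lift W₀ hW).left, ?_⟩
    rw [← Over.comp_left, equalizer.lift_ι]
    rfl

section Bridge

variable {S X T : Scheme.{u}} (p : X ⟶ S) (v : T ⟶ S)

/-- Compatibility: the two projections `(X ×_S X) ×_S T → X ×_S T` agree over `T`. [cite: GortzWedhorn2020, Section (4.7)] -/
theorem π_aux₁ : (pullback.fst (pullback.fst p p ≫ p) v ≫ pullback.fst p p) ≫ p = pullback.snd (pullback.fst p p ≫ p) v ≫ v := by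
  simpa using pullback.condition

/-- Compatibility for the second projection. [cite: GortzWedhorn2020, Section (4.7)] -/
theorem π_aux₂ : (pullback.fst (pullback.fst p p ≫ p) v ≫ pullback.snd p p) ≫ p = pullback.snd (pullback.fst p p ≫ p) v ≫ v := by
  rw [Category.assoc, ← pullback.condition (f := p) (g := p)]
  simpa using pullback.condition

/-- Compatibility for `σ : (X ×_S T) ×_T (X ×_S T) → (X ×_S X) ×_S T` (inner). [cite: GortzWedhorn2020, Section (4.7)] -/
theorem σ_aux₁ : (pullback.fst (pullback.snd p v) (pullback.snd p v) ≫ pullback.fst p v) ≫ p =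
    (pullback.snd (pullback.snd p v) (pullback.snd p v) ≫ pullback.fst p v) ≫ p := by
  simp only [Category.assoc, pullback.condition]
  rw [← Category.assoc, pullback.condition, Category.assoc]

/-- Compatibility for `σ` (outer). [cite: GortzWedhorn2020, Section (4.7)] -/
theorem σ_aux₂ : pullback.lift (pullback.fst (pullback.snd p v) (pullback.snd p v) ≫ pullback.fst p v)
      (pullback.snd (pullback.snd p v) (pullback.snd p v) ≫ pullback.fst p v) (σ_aux₁ p v) ≫ (pullback.fst p p ≫ p) =
    (pullback.fst (pullback.snd p v) (pullback.snd p v) ≫ pullback.snd p v) ≫ v := by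
  rw [pullback.lift_fst_assoc, Category.assoc, pullback.condition, Category.assoc]

/-- **`σ ≫ ρ = 𝟙`**: `(X ×_S T) ×_T (X ×_S T) → (X ×_S X) ×_S T → (X ×_S T) ×_T (X ×_S T)` is the identity. [cite: GortzWedhorn2020, Section (4.7)] -/
theorem σ_ρ :
    pullback.lift (pullback.lift (pullback.fst (pullback.snd p v) (pullback.snd p v) ≫ pullback.fst p v)
        (pullback.snd (pullback.snd p v) (pullback.snd p v) ≫ pullback.fst p v) (σ_aux₁ p v))
        (pullback.fst (pullback.snd p v) (pullback.snd p v) ≫ pullback.snd p v) (σ_aux₂ p v) ≫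
      pullback.lift
        (pullback.lift (pullback.fst (pullback.fst p p ≫ p) v ≫ pullback.fst p p) (pullback.snd (pullback.fst p p ≫ p) v) (π_aux₁ p v))
        (pullback.lift (pullback.fst (pullback.fst p p ≫ p) v ≫ pullback.snd p p) (pullback.snd (pullback.fst p p ≫ p) v) (π_aux₂ p v))
        (by simp) = 𝟙 _ := by
  apply pullback.hom_ext
  · apply pullback.hom_ext <;> simp
  · apply pullback.hom_ext <;> simp [pullback.condition]

/-- **`ρ ≫ σ = 𝟙`**. [cite: GortzWedhorn2020, Section (4.7)] -/
theorem ρ_σ :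
    pullback.lift
        (pullback.lift (pullback.fst (pullback.fst p p ≫ p) v ≫ pullback.fst p p) (pullback.snd (pullback.fst p p ≫ p) v) (π_aux₁ p v))
        (pullback.lift (pullback.fst (pullback.fst p p ≫ p) v ≫ pullback.snd p p) (pullback.snd (pullback.fst p p ≫ p) v) (π_aux₂ p v))
        (by simp) ≫
      pullback.lift (pullback.lift (pullback.fst (pullback.snd p v) (pullback.snd p v) ≫ pullback.fst p v)
        (pullback.snd (pullback.snd p v) (pullback.snd p v) ≫ pullback.fst p v) (σ_aux₁ p v))
        (pullback.fst (pullback.snd p v) (pullback.snd p v) ≫ pullback.snd p v) (σ_aux₂ p v) = 𝟙 _ := by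
  apply pullback.hom_ext
  · apply pullback.hom_ext <;> simp
  · simp

/-- **Points**: `pullback.lift a b ≫ σ` is the pair `((a_X, b_X), t)`. [cite: GortzWedhorn2020, Section (4.7)] -/
theorem lift_σ {W : Scheme.{u}} (a b : W ⟶ pullback p v) (hab : a ≫ pullback.snd p v = b ≫ pullback.snd p v)
    (h₁ : (a ≫ pullback.fst p v) ≫ p = (b ≫ pullback.fst p v) ≫ p)
    (h₂ : pullback.lift (a ≫ pullback.fst p v) (b ≫ pullback.fst p v) h₁ ≫ (pullback.fst p p ≫ p) = (a ≫ pullback.snd p v) ≫ v) :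
    pullback.lift a b hab ≫
      pullback.lift (pullback.lift (pullback.fst (pullback.snd p v) (pullback.snd p v) ≫ pullback.fst p v)
        (pullback.snd (pullback.snd p v) (pullback.snd p v) ≫ pullback.fst p v) (σ_aux₁ p v))
        (pullback.fst (pullback.snd p v) (pullback.snd p v) ≫ pullback.snd p v) (σ_aux₂ p v) =
      pullback.lift (pullback.lift (a ≫ pullback.fst p v) (b ≫ pullback.fst p v) h₁) (a ≫ pullback.snd p v) h₂ := by
  apply pullback.hom_ext
  · apply pullback.hom_ext <;> simp
  · simp

/-- **Points**: a pair `((a_X, b_X), t)` followed by `ρ` is `pullback.lift a b`. [cite: GortzWedhorn2020, Section (4.7)] -/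
theorem pair_ρ {W : Scheme.{u}} (a b : W ⟶ pullback p v) (hab : a ≫ pullback.snd p v = b ≫ pullback.snd p v)
    (h₁ : (a ≫ pullback.fst p v) ≫ p = (b ≫ pullback.fst p v) ≫ p)
    (h₂ : pullback.lift (a ≫ pullback.fst p v) (b ≫ pullback.fst p v) h₁ ≫ (pullback.fst p p ≫ p) = (a ≫ pullback.snd p v) ≫ v) :
    pullback.lift (pullback.lift (a ≫ pullback.fst p v) (b ≫ pullback.fst p v) h₁) (a ≫ pullback.snd p v) h₂ ≫
      pullback.lift
        (pullback.lift (pullback.fst (pullback.fst p p ≫ p) v ≫ pullback.fst p p) (pullback.snd (pullback.fst p p ≫ p) v) (π_aux₁ p v))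
        (pullback.lift (pullback.fst (pullback.fst p p ≫ p) v ≫ pullback.snd p p) (pullback.snd (pullback.fst p p ≫ p) v) (π_aux₂ p v))
        (by simp) = pullback.lift a b hab := by
  apply pullback.hom_ext
  · apply pullback.hom_ext <;> simp
  · apply pullback.hom_ext <;> simp [hab]

end Bridge

/-! ### §0b Pointwise evaluation of the rules (points `a b c : W ⟶ X ×_S T` over a common `W → T`) -/

section Pointwise

variable {S X T : Scheme.{u}} (p : X ⟶ S) (ε : S ⟶ X) (hε : ε ≫ p = 𝟙 S) (v : T ⟶ S)
  (φ : pullback (pullback.fst p p ≫ p) v ⟶ pullback p v) (hφ : φ ≫ pullback.snd p v = pullback.snd (pullback.fst p p ≫ p) v)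
  (ψ : pullback p v ⟶ pullback p v) (hψ : ψ ≫ pullback.snd p v = pullback.snd p v)
  {W : Scheme.{u}} (a b c : W ⟶ pullback p v) (hab : a ≫ pullback.snd p v = b ≫ pullback.snd p v) (hbc : b ≫ pullback.snd p v = c ≫ pullback.snd p v)

include hab in
/-- Compatibility: `(a_X, b_X)` is a point of `X ×_S X`. [cite: GortzWedhorn2020, Section (4.7)] -/
theorem triple_aux₁ : (a ≫ pullback.fst p v) ≫ p = (b ≫ pullback.fst p v) ≫ p := by
  rw [Category.assoc, Category.assoc, pullback.condition (f := p) (g := v), reassoc_of% hab]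

include hab hbc in
/-- Compatibility: `((a_X, b_X), c_X)` is a point of `X ×_S X ×_S X`. [cite: GortzWedhorn2020, Section (4.7)] -/
theorem triple_aux₂ : pullback.lift (a ≫ pullback.fst p v) (b ≫ pullback.fst p v) (triple_aux₁ p v a b hab) ≫ (pullback.fst p p ≫ p) =
    (c ≫ pullback.fst p v) ≫ p := by
  rw [pullback.lift_fst_assoc, Category.assoc, Category.assoc, pullback.condition (f := p) (g := v), reassoc_of% hab, reassoc_of% hbc]

include hab hbc in
/-- Compatibility: the triple lies over `T`. [cite: GortzWedhorn2020, Section (4.7)] -/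
theorem triple_aux₃ : pullback.lift (pullback.lift (a ≫ pullback.fst p v) (b ≫ pullback.fst p v) (triple_aux₁ p v a b hab)) (c ≫ pullback.fst p v)
      (triple_aux₂ p v a b c hab hbc) ≫ (pullback.fst (pullback.fst p p ≫ p) p ≫ pullback.fst p p ≫ p) = (a ≫ pullback.snd p v) ≫ v := by
  rw [pullback.lift_fst_assoc, pullback.lift_fst_assoc, Category.assoc, Category.assoc, pullback.condition (f := p) (g := v)]

include hφ hab hbc in
/-- **`assocL` on points**: `(a, b, c) ↦ (a·b)·c` with `x·y := pullback.lift x y ≫ σ ≫ φ`. [cite: MumfordFogartyKirwan1994, Ch. 6 §3 Proposition 6.16, proof (p. 126)] -/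
theorem triple_assocL (h₁ : (pullback.lift a b hab ≫ pullback.lift (pullback.lift (pullback.fst (pullback.snd p v) (pullback.snd p v) ≫ pullback.fst p v) (pullback.snd (pullback.snd p v) (pullback.snd p v) ≫ pullback.fst p v) (σ_aux₁ p v)) (pullback.fst (pullback.snd p v) (pullback.snd p v) ≫ pullback.snd p v) (σ_aux₂ p v) ≫ φ) ≫ pullback.snd p v = c ≫ pullback.snd p v) :
    pullback.lift (pullback.lift (pullback.lift (a ≫ pullback.fst p v) (b ≫ pullback.fst p v) (triple_aux₁ p v a b hab)) (c ≫ pullback.fst p v)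
        (triple_aux₂ p v a b c hab hbc)) (a ≫ pullback.snd p v) (triple_aux₃ p v a b c hab hbc) ≫ pullback.lift (pullback.lift ((pullback.lift (pullback.fst (pullback.fst (pullback.fst p p ≫ p) p ≫ pullback.fst p p ≫ p) v ≫ pullback.fst (pullback.fst p p ≫ p) p) (pullback.snd (pullback.fst (pullback.fst p p ≫ p) p ≫ pullback.fst p p ≫ p) v) (assoc_aux₁₂ p v) ≫ φ) ≫ pullback.fst p v) (pullback.fst (pullback.fst (pullback.fst p p ≫ p) p ≫ pullback.fst p p ≫ p) v ≫ pullback.snd (pullback.fst p p ≫ p) p) (assocL_aux p v φ hφ)) (pullback.snd (pullback.fst (pullback.fst p p ≫ p) p ≫ pullback.fst p p ≫ p) v) (unitL_aux₂' p v (assoc_aux₃ p v)) ≫ φ =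
      pullback.lift (pullback.lift a b hab ≫ pullback.lift (pullback.lift (pullback.fst (pullback.snd p v) (pullback.snd p v) ≫ pullback.fst p v) (pullback.snd (pullback.snd p v) (pullback.snd p v) ≫ pullback.fst p v) (σ_aux₁ p v)) (pullback.fst (pullback.snd p v) (pullback.snd p v) ≫ pullback.snd p v) (σ_aux₂ p v) ≫ φ) c h₁ ≫ pullback.lift (pullback.lift (pullback.fst (pullback.snd p v) (pullback.snd p v) ≫ pullback.fst p v) (pullback.snd (pullback.snd p v) (pullback.snd p v) ≫ pullback.fst p v) (σ_aux₁ p v)) (pullback.fst (pullback.snd p v) (pullback.snd p v) ≫ pullback.snd p v) (σ_aux₂ p v) ≫ φ := by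
  have e12 : pullback.lift (pullback.lift (pullback.lift (a ≫ pullback.fst p v) (b ≫ pullback.fst p v) (triple_aux₁ p v a b hab)) (c ≫ pullback.fst p v)
        (triple_aux₂ p v a b c hab hbc)) (a ≫ pullback.snd p v) (triple_aux₃ p v a b c hab hbc) ≫ pullback.lift (pullback.fst (pullback.fst (pullback.fst p p ≫ p) p ≫ pullback.fst p p ≫ p) v ≫ pullback.fst (pullback.fst p p ≫ p) p) (pullback.snd (pullback.fst (pullback.fst p p ≫ p) p ≫ pullback.fst p p ≫ p) v) (assoc_aux₁₂ p v) =
      pullback.lift a b hab ≫ pullback.lift (pullback.lift (pullback.fst (pullback.snd p v) (pullback.snd p v) ≫ pullback.fst p v) (pullback.snd (pullback.snd p v) (pullback.snd p v) ≫ pullback.fst p v) (σ_aux₁ p v)) (pullback.fst (pullback.snd p v) (pullback.snd p v) ≫ pullback.snd p v) (σ_aux₂ p v) := by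
    apply pullback.hom_ext
    · apply pullback.hom_ext <;> simp
    · simp
  simp only [← Category.assoc]
  congr 1
  simp only [Category.assoc]
  apply pullback.hom_ext
  · apply pullback.hom_ext
    · simp [reassoc_of% e12]
    · simp
  · simp [hφ]

include hφ hab hbc in
/-- **`assocR` on points**: `(a, b, c) ↦ a·(b·c)`. [cite: MumfordFogartyKirwan1994, Ch. 6 §3 Proposition 6.16, proof (p. 126)] -/
theorem triple_assocR (h₂ : a ≫ pullback.snd p v = (pullback.lift b c hbc ≫ pullback.lift (pullback.lift (pullback.fst (pullback.snd p v) (pullback.snd p v) ≫ pullback.fst p v) (pullback.snd (pullback.snd p v) (pullback.snd p v) ≫ pullback.fst p v) (σ_aux₁ p v)) (pullback.fst (pullback.snd p v) (pullback.snd p v) ≫ pullback.snd p v) (σ_aux₂ p v) ≫ φ) ≫ pullback.snd p v) :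
    pullback.lift (pullback.lift (pullback.lift (a ≫ pullback.fst p v) (b ≫ pullback.fst p v) (triple_aux₁ p v a b hab)) (c ≫ pullback.fst p v)
        (triple_aux₂ p v a b c hab hbc)) (a ≫ pullback.snd p v) (triple_aux₃ p v a b c hab hbc) ≫ pullback.lift (pullback.lift (pullback.fst (pullback.fst (pullback.fst p p ≫ p) p ≫ pullback.fst p p ≫ p) v ≫ pullback.fst (pullback.fst p p ≫ p) p ≫ pullback.fst p p) ((pullback.lift (pullback.lift (pullback.fst (pullback.fst (pullback.fst p p ≫ p) p ≫ pullback.fst p p ≫ p) v ≫ pullback.fst (pullback.fst p p ≫ p) p ≫ pullback.snd p p) (pullback.fst (pullback.fst (pullback.fst p p ≫ p) p ≫ pullback.fst p p ≫ p) v ≫ pullback.snd (pullback.fst p p ≫ p) p) (assoc_aux₂₃ p v)) (pullback.snd (pullback.fst (pullback.fst p p ≫ p) p ≫ pullback.fst p p ≫ p) v) (by rw [pullback.lift_fst_assoc, assoc_aux₂₃, assoc_aux₃]) ≫ φ) ≫ pullback.fst p v) (assocR_aux p v φ hφ)) (pullback.snd (pullback.fst (pullback.fst p p ≫ p) p ≫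 pullback.fst p p ≫ p) v) (unitL_aux₂' p v (assocR_aux' p v φ hφ)) ≫ φ =
      pullback.lift a (pullback.lift b c hbc ≫ pullback.lift (pullback.lift (pullback.fst (pullback.snd p v) (pullback.snd p v) ≫ pullback.fst p v) (pullback.snd (pullback.snd p v) (pullback.snd p v) ≫ pullback.fst p v) (σ_aux₁ p v)) (pullback.fst (pullback.snd p v) (pullback.snd p v) ≫ pullback.snd p v) (σ_aux₂ p v) ≫ φ) h₂ ≫ pullback.lift (pullback.lift (pullback.fst (pullback.snd p v) (pullback.snd p v) ≫ pullback.fst p v) (pullback.snd (pullback.snd p v) (pullback.snd p v) ≫ pullback.fst p v) (σ_aux₁ p v)) (pullback.fst (pullback.snd p v) (pullback.snd p v) ≫ pullback.snd p v) (σ_aux₂ p v) ≫ φ := by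
  have e23 : pullback.lift (pullback.lift (pullback.lift (a ≫ pullback.fst p v) (b ≫ pullback.fst p v) (triple_aux₁ p v a b hab)) (c ≫ pullback.fst p v)
        (triple_aux₂ p v a b c hab hbc)) (a ≫ pullback.snd p v) (triple_aux₃ p v a b c hab hbc) ≫ pullback.lift (pullback.lift (pullback.fst (pullback.fst (pullback.fst p p ≫ p) p ≫ pullback.fst p p ≫ p) v ≫ pullback.fst (pullback.fst p p ≫ p) p ≫ pullback.snd p p) (pullback.fst (pullback.fst (pullback.fst p p ≫ p) p ≫ pullback.fst p p ≫ p) v ≫ pullback.snd (pullback.fst p p ≫ p) p) (assoc_aux₂₃ p v)) (pullback.snd (pullback.fst (pullback.fst p p ≫ p) p ≫ pullback.fst p p ≫ p) v) (by rw [pullback.lift_fst_assoc, assoc_aux₂₃, assoc_aux₃]) =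
      pullback.lift b c hbc ≫ pullback.lift (pullback.lift (pullback.fst (pullback.snd p v) (pullback.snd p v) ≫ pullback.fst p v) (pullback.snd (pullback.snd p v) (pullback.snd p v) ≫ pullback.fst p v) (σ_aux₁ p v)) (pullback.fst (pullback.snd p v) (pullback.snd p v) ≫ pullback.snd p v) (σ_aux₂ p v) := by
    apply pullback.hom_ext
    · apply pullback.hom_ext <;> simp
    · simp [hab]
  simp only [← Category.assoc]
  congr 1
  simp only [Category.assoc]
  apply pullback.hom_ext
  · apply pullback.hom_ext
    · simp
    · simp [reassoc_of% e23]
  · simp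

include hε in
/-- **`unitL` on points**: `a ↦ ε_T·a`. [cite: MumfordFogartyKirwan1994, Ch. 6 §3 Proposition 6.16, proof (p. 126)] -/
theorem point_unitL (h : ((a ≫ pullback.snd p v) ≫ pullback.lift (v ≫ ε) (𝟙 T) (by simp [hε])) ≫ pullback.snd p v = a ≫ pullback.snd p v) :
    a ≫ (pullback.lift (pullback.lift (pullback.snd p v ≫ v ≫ ε) (pullback.fst p v) (unitL_aux₁ p ε hε v)) (pullback.snd p v) (unitL_aux₂ p v _ _ _ pullback.condition) ≫ φ) = pullback.lift ((a ≫ pullback.snd p v) ≫ pullback.lift (v ≫ ε) (𝟙 T) (by simp [hε])) a h ≫ pullback.lift (pullback.lift (pullback.fst (pullback.snd p v) (pullback.snd p v) ≫ pullback.fst p v) (pullback.snd (pullback.snd p v) (pullback.snd p v) ≫ pullback.fst p v) (σ_aux₁ p v)) (pullback.fst (pullback.snd p v) (pullback.snd p v) ≫ pullback.snd p v) (σ_aux₂ p v) ≫ φ := by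
  simp only [← Category.assoc]
  congr 1
  simp only [Category.assoc]
  apply pullback.hom_ext
  · apply pullback.hom_ext <;> simp
  · simp

include hε in
/-- **`unitR` on points**: `a ↦ a·ε_T`. [cite: MumfordFogartyKirwan1994, Ch. 6 §3 Proposition 6.16, proof (p. 126)] -/
theorem point_unitR (h : a ≫ pullback.snd p v = ((a ≫ pullback.snd p v) ≫ pullback.lift (v ≫ ε) (𝟙 T) (by simp [hε])) ≫ pullback.snd p v) :
    a ≫ (pullback.lift (pullback.lift (pullback.fst p v) (pullback.snd p v ≫ v ≫ ε) (unitL_aux₁ p ε hε v).symm) (pullback.snd p v) (unitL_aux₂ p v _ _ _ (by simp [hε])) ≫ φ) = pullback.lift a ((a ≫ pullback.snd p v) ≫ pullback.lift (v ≫ ε) (𝟙 T) (by simp [hε])) h ≫ pullback.lift (pullback.lift (pullback.fst (pullback.snd p v) (pullback.snd p v) ≫ pullback.fst p v) (pullback.snd (pullback.snd p v) (pullback.snd p v) ≫ pullback.fst p v) (σ_aux₁ p v)) (pullback.fst (pullback.snd p v) (pullback.snd p v) ≫ pullback.snd p v) (σ_aux₂ p v) ≫ φ := by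
  simp only [← Category.assoc]
  congr 1
  simp only [Category.assoc]
  apply pullback.hom_ext
  · apply pullback.hom_ext <;> simp
  · simp

include hψ in
/-- **`invL` on points**: `a ↦ a⁻¹·a` with `a⁻¹ := a ≫ ψ`. [cite: MumfordFogartyKirwan1994, Ch. 6 §3 Proposition 6.16, proof (p. 126)] -/
theorem point_invL (h : (a ≫ ψ) ≫ pullback.snd p v = a ≫ pullback.snd p v) :
    a ≫ (pullback.lift (pullback.lift (ψ ≫ pullback.fst p v) (pullback.fst p v) (invL_aux p v ψ hψ)) (pullback.snd p v) (unitL_aux₂ p v _ _ _ pullback.condition) ≫ φ) = pullback.lift (a ≫ ψ) a h ≫ pullback.lift (pullback.lift (pullback.fst (pullback.snd p v) (pullback.snd p v) ≫ pullback.fst p v) (pullback.snd (pullback.snd p v) (pullback.snd p v) ≫ pullback.fst p v) (σ_aux₁ p v)) (pullback.fst (pullback.snd p v) (pullback.snd p v) ≫ pullback.snd p v) (σ_aux₂ p v) ≫ φ := by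
  simp only [← Category.assoc]
  congr 1
  apply pullback.hom_ext
  · apply pullback.hom_ext <;> simp
  · simp [hψ]

include hε in
/-- **The constant rule on points**: `a ↦ ε_T(t_a)`. [cite: MumfordFogartyKirwan1994, Ch. 6 §3 Proposition 6.16, proof (p. 126)] -/
theorem point_constE :
    a ≫ (pullback.lift (pullback.snd p v ≫ v ≫ ε) (pullback.snd p v) (by simp [hε]) : pullback p v ⟶ pullback p v) =
      (a ≫ pullback.snd p v) ≫ pullback.lift (v ≫ ε) (𝟙 T) (by simp [hε]) := by
  apply pullback.hom_ext <;> simp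

end Pointwise

end Literature.AlgebraicGeometry.Morphisms

end
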